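import Literature.AlgebraicGeometry.AbelianSchemes.SerreTensorConstruction
import HarnessLib

/-!
# Functoriality of Serre's tensor construction `A ⊗_𝒪 𝔟` in `𝒪`-equivariant homomorphisms `A → A′`

Topic `AlgebraicGeometry/AbelianSchemes`, namespace `Literature.AlgebraicGeometry.AbelianSchemes.AbelianSchemeOver` (constructions with
bodies + proved theorems; no named fact, no `sorry`, no `instance`, no notation; any base `S`).  Cell `hodgecm-mathlib`, F0/P6 «MOD»,
P6a organ (g2) FILE 3 (FILE 1 ★ `AbelianSchemeIdempotentImage`, FILE 1b ★ `AbelianSchemeOverRingAction`, FILE 2 ★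
`SerreTensorConstruction`); `--supports stmt-HodgeConjecture-24832`, count-neutral.  HC_CM is proved only modulo the 2 remaining named
inputs (hLiu418, h413) until rung 0 closes; this file discharges none of them.

## Mathematics

For an `𝒪`-equivariant homomorphism `g : A → A′` of abelian schemes with commutative group laws (`ι′(a) ∘ g = g ∘ ι(a)`), the
coordinatewise map `gⁿ : Aⁿ → A′ⁿ` commutes with the matrix endomorphisms `[M]` (`[M] ≫ gⁿ = gⁿ ≫ [M]′`), hence carries
`A ⊗_𝒪 𝔟 = Fix([E])` into `A′ ⊗_𝒪 𝔟 = Fix([E]′)`: the induced homomorphism `g ⊗ 𝔟`, functorial (`𝟙 ⊗ 𝔟 = 𝟙`,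
`(g ≫ g′) ⊗ 𝔟 = (g ⊗ 𝔟) ≫ (g′ ⊗ 𝔟)`), given on points by `(x_k)_k ↦ (x_k ≫ g)_k`, and `𝒪`-equivariant for the induced actions
(B. Conrad, *Gross–Zagier revisited* §7: `M ⊗_R (·)` is a functor).  §1 is the general statement for a homomorphism `g : B → B′`
intertwining two idempotents `e`, `e′` (`g ≫ e′ = e ≫ g`): the induced `Fix(e) → Fix(e′)`, `ι ≫ g ≫ π′`.

## Contents

* §1 `fixedHom e e' he' g : fixedOver e ⟶ fixedOver e'` with `fixedHom_ι : _ ≫ ι′ = ι ≫ g` (under `g ≫ e' = e ≫ g`),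
  `isMonHom_fixedHom`, `fixedHom_id∕_comp∕_mul`;
* §2 `powMap g n : (A.pow n).X ⟶ (A'.pow n).X` (`powMap_powProj`, `powHomEquiv_comp_powMap`, `isMonHom_powMap`, `powMap_id∕_comp`),
  **`matrixEnd_comp_powMap : matrixEnd act M ≫ powMap g n = powMap g n ≫ matrixEnd act' M`** for equivariant `g`;
* §3 **`serreMap act act' E hE g : (serreTensor act E hE).X ⟶ (serreTensor act' E hE).X`** with `serreMap_ι`, `isMonHom_serreMap`,
  `serreHomEquiv_comp_serreMap` (points), `serreMap_id`, `serreMap_comp`, **`serreAction_comp_serreMap`** (equivariance).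

## References
* [Conrad2004GrossZagier] B. Conrad, *Gross–Zagier revisited*, MSRI Publ. 49 (2004), §7.
* [Kottwitz1992] §5 (p. 390); [MumfordFogartyKirwan1994] Ch. 6 §1 Def. 6.1, Cor. 6.4; [GortzWedhorn2020] Def. 9.1 (3), Prop. 9.3.
* Tree: ★ `AbelianSchemes/SerreTensorConstruction` (FILE 2) and its imports.
-/

noncomputable section

universe u

open CategoryTheory CategoryTheory.Limits AlgebraicGeometry MonoidalCategory CartesianMonoidalCategory
open scoped MonObj

namespace Literature.AlgebraicGeometry.AbelianSchemes

namespace AbelianSchemeOver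

variable {S : Scheme.{u}}

/-! ## §1 Maps between fixed subgroup schemes of idempotents induced by an intertwining homomorphism -/

section FixedHom

variable {B B' B'' : AbelianSchemeOver S} (e : B.X ⟶ B.X) [IsMonHom e] (he : e ≫ e = e)
  (e' : B'.X ⟶ B'.X) [IsMonHom e'] (he' : e' ≫ e' = e') (g : B.X ⟶ B'.X)

/-- For `g : B → B'` intertwining the idempotents (`g ≫ e' = e ≫ g`), the induced map `Fix(e) ⟶ Fix(e')`, `ι ≫ g ≫ π'`.
[cite: GortzWedhorn2020, Definition 9.1 (3) and Proposition 9.3] -/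
def fixedHom : fixedOver e ⟶ fixedOver e' := (fixedι e ≫ g) ≫ fixedπ e' he'

/-- `fixedHom ≫ ι' = ι ≫ g`. [cite: GortzWedhorn2020, Definition 9.1 (3) and Proposition 9.3] -/
@[reassoc]
theorem fixedHom_ι (hg : g ≫ e' = e ≫ g) : fixedHom e e' he' g ≫ fixedι e' = fixedι e ≫ g := by
  rw [fixedHom, Category.assoc, Category.assoc, fixedπ_comp_ι, hg, ← Category.assoc, fixedι_comp]

/-- `fixedHom` of a homomorphism is a homomorphism. [cite: GortzWedhorn2020, Definition 9.1 (3) and Proposition 9.3] -/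
theorem isMonHom_fixedHom [IsMonHom g] : IsMonHom (fixedHom e e' he' g) := by
  haveI := isMonHom_fixedι e
  haveI := isMonHom_fixedπ e' he'
  unfold fixedHom
  infer_instance

/-- `fixedHom (𝟙) = 𝟙`. [cite: GortzWedhorn2020, Definition 9.1 (3) and Proposition 9.3] -/
theorem fixedHom_id : fixedHom e e he (𝟙 B.X) = 𝟙 _ := by
  rw [fixedHom, Category.comp_id, fixedι_comp_π]

/-- `fixedHom (g ≫ g') = fixedHom g ≫ fixedHom g'`. [cite: GortzWedhorn2020, Definition 9.1 (3) and Proposition 9.3] -/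
theorem fixedHom_comp (hg : g ≫ e' = e ≫ g) (e'' : B''.X ⟶ B''.X) [IsMonHom e''] (he'' : e'' ≫ e'' = e'')
    (g' : B'.X ⟶ B''.X) (hg' : g' ≫ e'' = e' ≫ g') :
    fixedHom e e'' he'' (g ≫ g') = fixedHom e e' he' g ≫ fixedHom e' e'' he'' g' := by
  haveI := mono_fixedι e''
  have hgg' : (g ≫ g') ≫ e'' = e ≫ (g ≫ g') := by rw [Category.assoc, hg', ← Category.assoc, hg, Category.assoc]
  rw [← cancel_mono (fixedι e''), fixedHom_ι e e'' he'' (g ≫ g') hgg']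
  simp only [Category.assoc, fixedHom_ι e' e'' he'' g' hg', fixedHom_ι_assoc e e' he' g hg]

/-- `fixedHom (g * g') = fixedHom g * fixedHom g'` (commutative target). [cite: GortzWedhorn2020, Definition 9.1 (3) and Proposition 9.3] -/
theorem fixedHom_mul [IsCommMonObj B'.X] (g' : B.X ⟶ B'.X) (hg : g ≫ e' = e ≫ g) (hg' : g' ≫ e' = e ≫ g') :
    fixedHom e e' he' (g * g') = fixedHom e e' he' g * fixedHom e e' he' g' := by
  haveI := mono_fixedι e'
  haveI := isMonHom_fixedι e'
  have hgg' : (g * g') ≫ e' = e ≫ (g * g') := by rw [MonObj.mul_comp, MonObj.comp_mul, hg, hg']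
  rw [← cancel_mono (fixedι e'), fixedHom_ι e e' he' (g * g') hgg', MonObj.mul_comp, MonObj.comp_mul, fixedHom_ι e e' he' g hg,
    fixedHom_ι e e' he' g' hg']

end FixedHom

/-! ## §2 `gⁿ : Aⁿ ⟶ A'ⁿ` and its compatibility with the matrix action -/

section PowMap

variable {A A' A'' : AbelianSchemeOver S} (g : A.X ⟶ A'.X) (n : ℕ)

/-- `gⁿ : Aⁿ ⟶ A'ⁿ`, coordinatewise `g`. [cite: MumfordFogartyKirwan1994, Ch. 6 §1 Definition 6.1 (p. 115)] -/
def powMap : (A.pow n).X ⟶ (A'.pow n).X := powLift fun k => A.powProj n k ≫ g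

/-- `gⁿ ≫ pr_k = pr_k ≫ g`. [cite: MumfordFogartyKirwan1994, Ch. 6 §1 Definition 6.1 (p. 115)] -/
@[reassoc (attr := simp)]
theorem powMap_powProj (k : Fin n) : powMap g n ≫ A'.powProj n k = A.powProj n k ≫ g := by
  rw [powMap, powLift_powProj]

/-- On points: `(x ≫ gⁿ)_k = x_k ≫ g`. [cite: MumfordFogartyKirwan1994, Ch. 6 §1 Definition 6.1 (p. 115)] -/
theorem powHomEquiv_comp_powMap {T : Over S} (x : T ⟶ (A.pow n).X) (k : Fin n) :
    powHomEquiv A' n T (x ≫ powMap g n) k = powHomEquiv A n T x k ≫ g := by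
  rw [powHomEquiv_apply, powHomEquiv_apply, Category.assoc, powMap_powProj, Category.assoc]

/-- `gⁿ` is a homomorphism when `g` is. [cite: MumfordFogartyKirwan1994, Ch. 6 §1 Corollary 6.4 (p. 117)] -/
theorem isMonHom_powMap [IsMonHom g] : IsMonHom (powMap g n) := by
  unfold powMap
  refine isMonHom_powLift _ fun k => ?_
  haveI := A.isMonHom_powProj n k
  infer_instance

/-- `(𝟙)ⁿ = 𝟙`. [cite: MumfordFogartyKirwan1994, Ch. 6 §1 Definition 6.1 (p. 115)] -/
theorem powMap_id : powMap (𝟙 A.X) n = 𝟙 _ :=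
  pow_hom_ext fun k => by rw [powMap_powProj, Category.comp_id, Category.id_comp]

/-- `(g ≫ g')ⁿ = gⁿ ≫ g'ⁿ`. [cite: MumfordFogartyKirwan1994, Ch. 6 §1 Definition 6.1 (p. 115)] -/
theorem powMap_comp (g' : A'.X ⟶ A''.X) : powMap (g ≫ g') n = powMap g n ≫ powMap g' n :=
  pow_hom_ext fun k => by rw [powMap_powProj, Category.assoc, powMap_powProj, powMap_powProj_assoc]

variable {O : Type*} [CommRing O] (act : A.RingAction O) (act' : A'.RingAction O) [IsCommMonObj A.X] [IsCommMonObj A'.X]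

/-- An `𝒪`-EQUIVARIANT homomorphism commutes with the matrix action: `[M] ≫ gⁿ = gⁿ ≫ [M]'`.
[cite: Kottwitz1992, §5 (p. 390)] -/
theorem matrixEnd_comp_powMap [IsMonHom g] (hga : ∀ a, act.i a ≫ g = g ≫ act'.i a) (M : Matrix (Fin n) (Fin n) O) :
    matrixEnd act M ≫ powMap g n = powMap g n ≫ matrixEnd act' M := by
  apply (powHomEquiv A' n _).injective
  funext j
  rw [powHomEquiv_comp_powMap, ← Category.id_comp (matrixEnd act M), powHomEquiv_comp_matrixEnd,
    powHomEquiv_comp_matrixEnd]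
  unfold matrixComp
  rw [finset_prod_comp]
  refine Finset.prod_congr rfl fun k _ => ?_
  rw [Category.assoc, hga, ← Category.assoc, ← powHomEquiv_comp_powMap, Category.id_comp]

end PowMap

/-! ## §3 `A ⊗_𝒪 𝔟` is functorial in equivariant homomorphisms `A → A'` -/

section SerreMap

variable {A A' A'' : AbelianSchemeOver S} {O : Type*} [CommRing O] (act : A.RingAction O) (act' : A'.RingAction O)
  (act'' : A''.RingAction O) [IsCommMonObj A.X] [IsCommMonObj A'.X] [IsCommMonObj A''.X] {n : ℕ}
  (E : Matrix (Fin n) (Fin n) O) (hE : E * E = E) (g : A.X ⟶ A'.X) [IsMonHom g] (hga : ∀ a, act.i a ≫ g = g ≫ act'.i a)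

/-- **`g ⊗ 𝔟 : A ⊗_𝒪 𝔟 ⟶ A' ⊗_𝒪 𝔟`** for an `𝒪`-equivariant homomorphism `g : A → A'` (`gⁿ` commutes with `[E]`).
[cite: Conrad2004GrossZagier, §7] -/
def serreMap : (serreTensor act E hE).X ⟶ (serreTensor act' E hE).X :=
  haveI := isMonHom_matrixEnd act E
  haveI := isMonHom_matrixEnd act' E
  fixedHom (matrixEnd act E) (matrixEnd act' E) (matrixEnd_idem act' hE) (powMap g n)

include hga in
/-- `(g ⊗ 𝔟) ≫ ι' = ι ≫ gⁿ`. [cite: Conrad2004GrossZagier, §7] -/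
@[reassoc]
theorem serreMap_ι : serreMap act act' E hE g ≫ serreι act' E hE = serreι act E hE ≫ powMap g n :=
  haveI := isMonHom_matrixEnd act E
  haveI := isMonHom_matrixEnd act' E
  fixedHom_ι (matrixEnd act E) (matrixEnd act' E) (matrixEnd_idem act' hE) (powMap g n)
    ((matrixEnd_comp_powMap g n act act' hga E).symm)

/-- `g ⊗ 𝔟` is a homomorphism. [cite: Conrad2004GrossZagier, §7] -/
theorem isMonHom_serreMap : IsMonHom (serreMap act act' E hE g) := by
  haveI := isMonHom_matrixEnd act E
  haveI := isMonHom_matrixEnd act' E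
  haveI := isMonHom_powMap g n
  exact isMonHom_fixedHom (matrixEnd act E) (matrixEnd act' E) (matrixEnd_idem act' hE) (powMap g n)

include hga in
/-- On points: `(t ≫ (g ⊗ 𝔟))_k = t_k ≫ g`. [cite: Conrad2004GrossZagier, §7] -/
theorem serreHomEquiv_comp_serreMap {T : Over S} (t : T ⟶ (serreTensor act E hE).X) (k : Fin n) :
    (serreHomEquiv act' E hE T (t ≫ serreMap act act' E hE g) : Fin n → (T ⟶ A'.X)) k =
      (serreHomEquiv act E hE T t : Fin n → (T ⟶ A.X)) k ≫ g := by
  simp only [serreHomEquiv_apply_coe, Category.assoc, serreMap_ι_assoc act act' E hE g hga, powMap_powProj]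

/-- `𝟙 ⊗ 𝔟 = 𝟙`. [cite: Conrad2004GrossZagier, §7] -/
theorem serreMap_id : serreMap act act E hE (𝟙 A.X) = 𝟙 _ := by
  haveI := isMonHom_matrixEnd act E
  unfold serreMap
  rw [powMap_id]
  exact fixedHom_id (matrixEnd act E) (matrixEnd_idem act hE)

include hga in
/-- `(g ≫ g') ⊗ 𝔟 = (g ⊗ 𝔟) ≫ (g' ⊗ 𝔟)`. [cite: Conrad2004GrossZagier, §7] -/
theorem serreMap_comp (g' : A'.X ⟶ A''.X) [IsMonHom g'] (hga' : ∀ a, act'.i a ≫ g' = g' ≫ act''.i a) :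
    serreMap act act'' E hE (g ≫ g') = serreMap act act' E hE g ≫ serreMap act' act'' E hE g' := by
  haveI := isMonHom_matrixEnd act E
  haveI := isMonHom_matrixEnd act' E
  haveI := isMonHom_matrixEnd act'' E
  unfold serreMap
  rw [powMap_comp]
  exact fixedHom_comp (matrixEnd act E) (matrixEnd act' E) (matrixEnd_idem act' hE) (powMap g n)
    ((matrixEnd_comp_powMap g n act act' hga E).symm) (matrixEnd act'' E) (matrixEnd_idem act'' hE) (powMap g' n)
    ((matrixEnd_comp_powMap g' n act' act'' hga' E).symm)

include hga in
/-- `g ⊗ 𝔟` is `𝒪`-equivariant for the induced actions. [cite: Conrad2004GrossZagier, §7] -/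
theorem serreAction_comp_serreMap (a : O) :
    (serreAction act E hE).i a ≫ serreMap act act' E hE g = serreMap act act' E hE g ≫ (serreAction act' E hE).i a := by
  haveI := (isMonHom_serreι_serreπ act' E hE).2.2
  rw [← cancel_mono (serreι act' E hE)]
  simp only [Category.assoc, serreMap_ι act act' E hE g hga, serreMap_ι_assoc act act' E hE g hga, serreAction_i_comp_ι,
    serreAction_i_comp_ι_assoc, matrixEnd_comp_powMap g n act act' hga]

end SerreMap

end AbelianSchemeOver

end Literature.AlgebraicGeometry.AbelianSchemes

end
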